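import Literature.NumberTheory.Sieve.DiamondHalberstamRichertWeights
import Literature.NumberTheory.Sieve.DiamondHalberstamSieveInputs
import Literature.NumberTheory.Sieve.DiamondHalberstamBetaSieveTwo
import Literature.NumberTheory.Sieve.DiamondHalberstamTwoLinearSetup
import HarnessLib

/-!
# The weighted prime sum of the Diamond–Halberstam / Halberstam–Richert weighted sieve (`g = 2`)

Topic `Literature/NumberTheory/Sieve`. In the weighted sieve of Diamond–Halberstam 1997, Thm 1
(= Halberstam–Richert Thm 10.1) the sifted sum is compared with the weighted prime sum
`T = ∑_{z ≤ p < y} (1 − log p/log y) S_p`, `S_p = #{n ≤ N : (f(n), P(z)) = 1, p ∣ f(n)}`, and `T` is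
evaluated by the UPPER-bound sieve for the `S_p` followed by partial summation against the density.
This file PROVES a version of that evaluation in which partial summation is replaced by a Riemann-type
upper sum over `K = 197` pieces of the range `[z, y) = [N^{73/500}, N^{270/500})` (level
`D = N^{498/500}`), with Iwaniec's `β`-sieve of dimension `2` (`F₂ = A₂/s²` on the whole range needed)
as the upper-bound sieve:

* `sum_density_primesIn_le` — under `Ω(2, L)`: `∑_{w ≤ p < w'} g(p) ≤ 2 log(log w'/log w) + L/log w`.
* `sum_primesIn_eq_sum_range`, `sum_mul_le_of_pieces` — splitting a prime sum along monotone
  points and bounding it piecewise by `sup × (window density sum)`.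
* `DH97.gExp = 73/500`, `DH97.θExp = 498/500`, `DH97.αExp = 270/500`, `DH97.tPt i = (73+i)/500`,
  `DH97.pieceCoeff`, `DH97.pieceSum` and the certificate `DH97.pieceSum_le : pieceSum ≤ 0.046789`
  (`norm_num`; the corresponding integral `2∫ (1 − t/α) F₂((θ−t)/g)/A₂ dt/t` is `0.0466…`).
* `DH97.weightedPrimeSum_le` — for `f ∈ ℤ[X]` with `ω_f(2) ≤ 1`, `ω_f(p) ≤ 2`: there is `C ≥ 0` with
  `T ≤ N V(z) (A₂ · pieceSum + 197 A₂ ε_N + C ℓ_N (6 + 197 ε_N)) + D e⁸ log² z (4 + ε_N)`,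
  `ε_N = L₀/(g log N)`, `ℓ_N = ((θ − α) log N)^{−1/3}`, for all `N` with `N^g ≥ 2`
  (`L₀ = 106 e^{106/log 2}` from `hasIwaniecDimension_rootDensity`).

## References

* H. Diamond, H. Halberstam, LMS LN 237 (1997), 101–107, Thm 1 and (1). [DiamondHalberstam1997]
* H. Halberstam, H.-E. Richert, *Sieve Methods* (1974), Thm 10.1. [HalberstamRichert1974]
* H. Iwaniec, *Rosser's sieve*, Acta Arith. 36 (1980), Thm 1. [IwaniecActaArith1980]
-/

open Finset Real Polynomial

noncomputable section

namespace Literature.NumberTheory.Sieve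

open RichertWeights

/-! ### Window sums of a density of dimension `Ω(2, L)` -/

/-- **Window sum of the density**: under `Ω(2, L)`, for `2 ≤ w ≤ w'`,
`∑_{w ≤ p < w'} g(p) ≤ 2 log(log w'/log w) + L/log w`
(`g ≤ −log(1 − g)`, the logarithm of the dimension condition, `log(1 + x) ≤ x`). [folklore] -/
theorem sum_density_primesIn_le {g : ArithmeticFunction ℝ} {L w w' : ℝ}
    (hdim : HasIwaniecDimension g 2 L) (hw : 2 ≤ w) (hww' : w ≤ w') :
    ∑ p ∈ primesIn w w', g p ≤ 2 * Real.log (Real.log w' / Real.log w) + L / Real.log w := by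
  have hlogw : 0 < Real.log w := Real.log_pos (by linarith)
  have hlogw' : 0 < Real.log w' := Real.log_pos (by linarith)
  have hL : 0 ≤ L := hdim.nonneg
  have hprod := hdim.2 w w' hw hww'
  have hg : ∀ p ∈ primesIn w w', 0 ≤ g p ∧ g p < 1 := fun p hp =>
    hdim.1 p (mem_primesIn.mp hp).1
  -- `g p ≤ log ((1 - g p)⁻¹)`
  have h1 : ∑ p ∈ primesIn w w', g p ≤ ∑ p ∈ primesIn w w', Real.log ((1 - g p)⁻¹) := by
    refine Finset.sum_le_sum fun p hp => ?_
    obtain ⟨h0, h1⟩ := hg p hp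
    rw [Real.log_inv]
    linarith [Real.log_le_sub_one_of_pos (by linarith : 0 < 1 - g p)]
  have h2 : ∑ p ∈ primesIn w w', Real.log ((1 - g p)⁻¹) = Real.log (∏ p ∈ primesIn w w', (1 - g p)⁻¹) := by
    rw [Real.log_prod]
    intro p hp
    exact (inv_pos.mpr (by linarith [(hg p hp).2])).ne'
  have hpos : 0 < ∏ p ∈ primesIn w w', (1 - g p)⁻¹ :=
    Finset.prod_pos fun p hp => inv_pos.mpr (by linarith [(hg p hp).2])
  have hratio : 0 < Real.log w' / Real.log w := div_pos hlogw' hlogw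
  have h3 : Real.log (∏ p ∈ primesIn w w', (1 - g p)⁻¹) ≤
      Real.log ((Real.log w' / Real.log w) ^ (2 : ℝ) * (1 + L / Real.log w)) :=
    Real.log_le_log hpos hprod
  have h4 : Real.log ((Real.log w' / Real.log w) ^ (2 : ℝ) * (1 + L / Real.log w)) =
      2 * Real.log (Real.log w' / Real.log w) + Real.log (1 + L / Real.log w) := by
    rw [Real.log_mul (Real.rpow_pos_of_pos hratio 2).ne' (by positivity), Real.log_rpow hratio]
  have h5 : Real.log (1 + L / Real.log w) ≤ L / Real.log w := by
    have := Real.log_le_sub_one_of_pos (by positivity : 0 < 1 + L / Real.log w); linarith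
  linarith

/-! ### Splitting a prime sum along monotone points -/

/-- `primesIn a c = primesIn a b ∪ primesIn b c` for `a ≤ b ≤ c`. [folklore] -/
theorem primesIn_eq_union {a b c : ℝ} (hab : a ≤ b) (hbc : b ≤ c) :
    primesIn a c = primesIn a b ∪ primesIn b c := by
  ext p
  simp only [Finset.mem_union, mem_primesIn]
  constructor
  · rintro ⟨hp, h1, h2⟩
    rcases lt_or_ge (p : ℝ) b with h | h
    · exact Or.inl ⟨hp, h1, h⟩
    · exact Or.inr ⟨hp, h, h2⟩
  · rintro (⟨hp, h1, h2⟩ | ⟨hp, h1, h2⟩)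
    · exact ⟨hp, h1, lt_of_lt_of_le h2 hbc⟩
    · exact ⟨hp, hab.trans h1, h2⟩

/-- `primesIn a b` and `primesIn b c` are disjoint. [folklore] -/
theorem disjoint_primesIn (a b c : ℝ) : Disjoint (primesIn a b) (primesIn b c) := by
  rw [Finset.disjoint_left]
  intro p h1 h2
  rw [mem_primesIn] at h1 h2
  linarith [h1.2.2, h2.2.1]

/-- Splitting a sum over `primesIn a c` at `b ∈ [a, c]`. [folklore] -/
theorem sum_primesIn_add {a b c : ℝ} (hab : a ≤ b) (hbc : b ≤ c) (φ : ℕ → ℝ) :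
    ∑ p ∈ primesIn a c, φ p = ∑ p ∈ primesIn a b, φ p + ∑ p ∈ primesIn b c, φ p := by
  rw [primesIn_eq_union hab hbc, Finset.sum_union (disjoint_primesIn a b c)]

/-- Splitting a sum over `primesIn (u 0) (u K)` along monotone points `u 0 ≤ u 1 ≤ ⋯ ≤ u K`.
[folklore] -/
theorem sum_primesIn_eq_sum_range {u : ℕ → ℝ} (hu : Monotone u) (φ : ℕ → ℝ) (K : ℕ) :
    ∑ p ∈ primesIn (u 0) (u K), φ p = ∑ i ∈ range K, ∑ p ∈ primesIn (u i) (u (i + 1)), φ p := by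
  induction K with
  | zero =>
    rw [Finset.sum_range_zero]
    refine Finset.sum_eq_zero fun p hp => ?_
    rw [mem_primesIn] at hp
    linarith [hp.2.1, hp.2.2]
  | succ K ih =>
    rw [Finset.sum_range_succ, ← ih]
    exact sum_primesIn_add (hu (Nat.zero_le K)) (hu (Nat.le_succ K)) φ

/-- **Piecewise bound of a prime sum against a density of dimension `Ω(2, L)`**: if
`0 ≤ φ(p) ≤ M_i` on the `i`-th window `[u_i, u_{i+1})` (`u` monotone, `u_0 ≥ 2`, `M_i ≥ 0`), then
`∑_{u_0 ≤ p < u_K} g(p) φ(p) ≤ ∑_{i<K} M_i (2 log(log u_{i+1}/log u_i) + L/log u_i)`. [folklore] -/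
theorem sum_mul_le_of_pieces {g : ArithmeticFunction ℝ} {L : ℝ} (hdim : HasIwaniecDimension g 2 L)
    {u : ℕ → ℝ} (hu : Monotone u) (hu0 : 2 ≤ u 0) (K : ℕ) {φ : ℕ → ℝ} {M : ℕ → ℝ}
    (hM0 : ∀ i, i < K → 0 ≤ M i)
    (hM : ∀ i, i < K → ∀ p ∈ primesIn (u i) (u (i + 1)), 0 ≤ φ p ∧ φ p ≤ M i) :
    ∑ p ∈ primesIn (u 0) (u K), g p * φ p ≤
      ∑ i ∈ range K, M i * (2 * Real.log (Real.log (u (i + 1)) / Real.log (u i)) + L / Real.log (u i)) := by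
  rw [sum_primesIn_eq_sum_range hu _ K]
  refine Finset.sum_le_sum fun i hi => ?_
  rw [Finset.mem_range] at hi
  have hui : 2 ≤ u i := hu0.trans (hu (Nat.zero_le i))
  have hg : ∀ p ∈ primesIn (u i) (u (i + 1)), 0 ≤ g p := fun p hp =>
    (hdim.1 p (mem_primesIn.mp hp).1).1
  calc ∑ p ∈ primesIn (u i) (u (i + 1)), g p * φ p
      ≤ ∑ p ∈ primesIn (u i) (u (i + 1)), g p * M i :=
        Finset.sum_le_sum fun p hp => mul_le_mul_of_nonneg_left (hM i hi p hp).2 (hg p hp)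
    _ = M i * ∑ p ∈ primesIn (u i) (u (i + 1)), g p := by rw [← Finset.sum_mul, mul_comm]
    _ ≤ M i * (2 * Real.log (Real.log (u (i + 1)) / Real.log (u i)) + L / Real.log (u i)) :=
        mul_le_mul_of_nonneg_left (sum_density_primesIn_le hdim hui (hu (Nat.le_succ i))) (hM0 i hi)

/-! ### The grid of exponents and the rational certificate -/

namespace DH97

/-- The sifting exponent `g = 73/500` (`z = N^g`). [cite: DiamondHalberstam1997, Thm 1 (choice of `v = 1/g`)] -/
def gExp : ℝ := 73 / 500

/-- The level exponent `θ = 498/500` (`D = N^θ`). [cite: DiamondHalberstam1997, Thm 1 (`τ = 1`)] -/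
def θExp : ℝ := 498 / 500

/-- The weight exponent `α = 270/500` (`y = N^α`). [cite: DiamondHalberstam1997, Thm 1 (choice of `u = 1/α`)] -/
def αExp : ℝ := 270 / 500

/-- The partition points `t_i = (73 + i)/500`, `0 ≤ i ≤ 197`, of `[g, α]`. [folklore] -/
def tPt (i : ℕ) : ℝ := (73 + i) / 500

/-- The coefficient of the `i`-th piece: `c_i = (1 − t_i/α) (g/(θ − t_{i+1}))²`
(`= ((197 − i)/270) (73/(424 − i))²`). [folklore] -/
def pieceCoeff (i : ℕ) : ℝ := (1 - tPt i / αExp) * (gExp / (θExp - tPt (i + 1))) ^ 2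

/-- The Riemann-type upper sum `S_K = ∑_{i<197} c_i · 2 (t_{i+1} − t_i)/t_i = ∑_{i<197} c_i · 2/(73+i)`,
which dominates `2 ∫_g^α (1 − t/α) (g/(θ−t))² dt/t = (1/A₂) · 2∫ (1 − t/α) F₂((θ − t)/g) dt/t`. [folklore] -/
def pieceSum : ℝ := ∑ i ∈ range 197, pieceCoeff i * (2 / (73 + i))

/-- Unfolding the grid numbers. [folklore] -/
theorem tPt_apply (i : ℕ) : tPt i = (73 + i) / 500 := rfl

/-- `t_0 = g`. [folklore] -/
theorem tPt_zero : tPt 0 = gExp := by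
  rw [tPt_apply, gExp]; norm_num

/-- `t_197 = α`. [folklore] -/
theorem tPt_197 : tPt 197 = αExp := by
  rw [tPt_apply, αExp]; norm_num

/-- `t` is monotone. [folklore] -/
theorem tPt_mono : Monotone tPt := fun i j hij => by
  simp only [tPt]; gcongr

/-- `g ≤ t_i`. [folklore] -/
theorem gExp_le_tPt (i : ℕ) : gExp ≤ tPt i := by
  rw [← tPt_zero]; exact tPt_mono (Nat.zero_le i)

/-- `t_{i+1} ≤ α` for `i < 197`. [folklore] -/
theorem tPt_succ_le (i : ℕ) (hi : i < 197) : tPt (i + 1) ≤ αExp := by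
  rw [← tPt_197]; exact tPt_mono (by omega)

/-- `t_{i+1} − t_i = 1/500` and `log(t_{i+1}/t_i) ≤ 1/(73 + i)`. [folklore] -/
theorem log_tPt_succ_div_le (i : ℕ) : Real.log (tPt (i + 1) / tPt i) ≤ 1 / (73 + i) := by
  have h0 : 0 < tPt i := by rw [tPt_apply]; positivity
  have h := Real.log_le_sub_one_of_pos (div_pos (by rw [tPt_apply]; positivity : 0 < tPt (i + 1)) h0)
  have e : tPt (i + 1) / tPt i - 1 = 1 / (73 + i) := by
    rw [tPt_apply, tPt_apply]
    have : (73 : ℝ) + i ≠ 0 := by positivity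
    field_simp
    push_cast
    ring
  linarith

/-- The piece coefficient in closed rational form. [folklore] -/
theorem pieceCoeff_eq (i : ℕ) :
    pieceCoeff i = (270 - (73 + (i : ℝ))) / 270 * (73 / (498 - (73 + (i : ℝ) + 1))) ^ 2 := by
  have hA : 1 - tPt i / αExp = (270 - (73 + (i : ℝ))) / 270 := by
    rw [tPt_apply, αExp]; field_simp
  have hB : gExp / (θExp - tPt (i + 1)) = 73 / (498 - (73 + (i : ℝ) + 1)) := by
    rw [gExp, θExp, tPt_apply]
    have e : (498 : ℝ) / 500 - (73 + ((i + 1 : ℕ) : ℝ)) / 500 = (498 - (73 + (i : ℝ) + 1)) / 500 := by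
      push_cast; ring
    rw [e, div_div_div_cancel_right₀ (by norm_num : (500 : ℝ) ≠ 0)]
  rw [pieceCoeff, hA, hB]

/-- `0 ≤ c_i ≤ 1` for `i < 197`. [folklore] -/
theorem pieceCoeff_nonneg_le_one (i : ℕ) (hi : i < 197) : 0 ≤ pieceCoeff i ∧ pieceCoeff i ≤ 1 := by
  unfold pieceCoeff
  have hi' : (i : ℝ) ≤ 196 := by exact_mod_cast Nat.lt_succ_iff.mp hi
  have h1 : 0 ≤ 1 - tPt i / αExp ∧ 1 - tPt i / αExp ≤ 1 := by
    rw [tPt_apply, αExp]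
    constructor
    · rw [sub_nonneg, div_le_one (by norm_num)]; linarith
    · rw [sub_le_self_iff]; positivity
  have h2 : 0 ≤ (gExp / (θExp - tPt (i + 1))) ^ 2 ∧ (gExp / (θExp - tPt (i + 1))) ^ 2 ≤ 1 := by
    refine ⟨sq_nonneg _, ?_⟩
    have hden : 0 < θExp - tPt (i + 1) := by rw [θExp, tPt_apply]; push_cast; linarith
    have hle : gExp / (θExp - tPt (i + 1)) ≤ 1 := by
      rw [div_le_one hden, gExp, θExp, tPt_apply]; push_cast; linarith
    have hge : 0 ≤ gExp / (θExp - tPt (i + 1)) := div_nonneg (by rw [gExp]; norm_num) hden.le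
    nlinarith
  exact ⟨mul_nonneg h1.1 h2.1, mul_le_one₀ h1.2 h2.1 h2.2⟩

set_option maxRecDepth 20000 in
/-- **The rational certificate**: `S_K ≤ 0.046789` (exact rational arithmetic over the `197`
pieces; the true value is `0.0467887…`). [folklore] -/
theorem pieceSum_le : pieceSum ≤ 46789 / 1000000 := by
  unfold pieceSum
  simp only [pieceCoeff_eq]
  simp only [Finset.sum_range_succ, Finset.sum_range_zero]
  norm_num1

/-- `0 ≤ S_K`. [folklore] -/
theorem pieceSum_nonneg : 0 ≤ pieceSum := by
  unfold pieceSum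
  refine Finset.sum_nonneg fun i hi => ?_
  rw [Finset.mem_range] at hi
  exact mul_nonneg (pieceCoeff_nonneg_le_one i hi).1 (by positivity)

/-! ### Elementary facts about the scales `N^t` -/

/-- If `N^g ≥ 2` (with `N ≥ 0`) then `N > 1`. [folklore] -/
theorem one_lt_of_two_le_rpow {n t : ℝ} (hn0 : 0 ≤ n) (ht : 0 < t) (h : 2 ≤ n ^ t) : 1 < n := by
  by_contra hle
  push Not at hle
  have : n ^ t ≤ 1 := Real.rpow_le_one hn0 hle ht.le
  linarith

/-- A prime in the window `[N^a, N^b)` (`N > 1`) has `a log N ≤ log p < b log N`. [folklore] -/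
theorem log_bounds_of_mem_primesIn {n a b : ℝ} (hn : 1 < n) {p : ℕ}
    (hp : p ∈ primesIn (n ^ a) (n ^ b)) :
    p.Prime ∧ a * Real.log n ≤ Real.log p ∧ Real.log p < b * Real.log n := by
  rw [mem_primesIn] at hp
  obtain ⟨hpp, h1, h2⟩ := hp
  have hn0 : 0 < n := by linarith
  have hp0 : (0 : ℝ) < p := by exact_mod_cast hpp.pos
  refine ⟨hpp, ?_, ?_⟩
  · rw [← Real.log_rpow hn0]
    exact Real.log_le_log (Real.rpow_pos_of_pos hn0 a) h1
  · rw [← Real.log_rpow hn0]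
    exact Real.log_lt_log hp0 h2

/-- `(θ − g)/g ≤ β_2 + 1` (`425/73 = 5.82… < 5.8339 < β_2 + 1`): on the whole range of the weights
`F₂` is given by `A₂/s²`. [folklore] -/
theorem sMax_le_beta_add_one : (θExp - gExp) / gExp ≤ iwaniecSiftingLimit 2 + 1 := by
  have := BetaSieveTwo.iwaniecSiftingLimit_two_gt
  rw [θExp, gExp]
  norm_num
  linarith

/-- **Pointwise bounds on the `i`-th piece** (`N > 1`, `i < 197`, `N^{t_i} ≤ p < N^{t_{i+1}}`): the
logarithmic weight satisfies `0 ≤ 1 − log p/log y ≤ 1 − t_i/α` (`y = N^α`), and the sieve function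
at `s_p = log(D/p)/log z` (`D = N^θ`, `z = N^g`) satisfies `0 ≤ F₂(s_p) ≤ A₂ (g/(θ − t_{i+1}))²`
(`F₂ = A₂/s²` is decreasing on `(0, β_2 + 1] ⊇ [(θ−α)/g, (θ−g)/g]`). [folklore] -/
theorem piece_pointwise {n : ℝ} (hn : 1 < n) {i : ℕ} (hi : i < 197) {p : ℕ}
    (hp : p ∈ primesIn (n ^ tPt i) (n ^ tPt (i + 1))) :
    0 ≤ logWeight (n ^ αExp) p ∧ logWeight (n ^ αExp) p ≤ 1 - tPt i / αExp ∧
      0 ≤ iwaniecUpperSieveFun 2 (Real.log (n ^ θExp / p) / Real.log (n ^ gExp)) ∧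
        iwaniecUpperSieveFun 2 (Real.log (n ^ θExp / p) / Real.log (n ^ gExp)) ≤
          iwaniecSieveConst 2 * (gExp / (θExp - tPt (i + 1))) ^ 2 := by
  obtain ⟨hpp, hlo, hhi⟩ := log_bounds_of_mem_primesIn hn hp
  have hn0 : 0 < n := by linarith
  have hlogn : 0 < Real.log n := Real.log_pos hn
  have hp0 : (0 : ℝ) < p := by exact_mod_cast hpp.pos
  have hti : gExp ≤ tPt i := gExp_le_tPt i
  have hti1 : tPt (i + 1) ≤ αExp := tPt_succ_le i hi
  have htii : tPt i ≤ tPt (i + 1) := tPt_mono (Nat.le_succ i)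
  have hg0 : 0 < gExp := by rw [gExp]; norm_num
  have hα0 : 0 < αExp := by rw [αExp]; norm_num
  have hθα : αExp < θExp := by rw [αExp, θExp]; norm_num
  -- the weight
  have hlw : logWeight (n ^ αExp) p = 1 - Real.log p / (αExp * Real.log n) := by
    rw [logWeight_apply, Real.log_rpow hn0]
  have hαlog : 0 < αExp * Real.log n := mul_pos hα0 hlogn
  refine ⟨?_, ?_, ?_, ?_⟩
  · rw [hlw, sub_nonneg, div_le_one hαlog]
    have : tPt (i + 1) * Real.log n ≤ αExp * Real.log n := mul_le_mul_of_nonneg_right hti1 hlogn.le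
    linarith
  · rw [hlw, sub_le_sub_iff_left, div_le_div_iff₀ hα0 hαlog]
    nlinarith
  · -- `F₂(s_p) = A₂/s_p² ≥ 0`
    have hs : Real.log (n ^ θExp / p) / Real.log (n ^ gExp) = (θExp * Real.log n - Real.log p) / (gExp * Real.log n) := by
      rw [Real.log_div (Real.rpow_pos_of_pos hn0 _).ne' hp0.ne', Real.log_rpow hn0, Real.log_rpow hn0]
    have hs0 : 0 < (θExp * Real.log n - Real.log p) / (gExp * Real.log n) := by
      apply div_pos _ (mul_pos hg0 hlogn)
      have : Real.log p < θExp * Real.log n := by nlinarith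
      linarith
    have hs1 : (θExp * Real.log n - Real.log p) / (gExp * Real.log n) ≤ iwaniecSiftingLimit 2 + 1 := by
      refine le_trans ?_ sMax_le_beta_add_one
      rw [div_le_div_iff₀ (mul_pos hg0 hlogn) hg0]
      have : gExp * Real.log n ≤ Real.log p := le_trans (mul_le_mul_of_nonneg_right hti hlogn.le) hlo
      nlinarith
    rw [hs, BetaSieveTwo.iwaniecUpperSieveFun_two_eq hs0 hs1]
    exact div_nonneg BetaSieveTwo.iwaniecSieveConst_two_pos.le (sq_nonneg _)
  · have hs : Real.log (n ^ θExp / p) / Real.log (n ^ gExp) = (θExp * Real.log n - Real.log p) / (gExp * Real.log n) := by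
      rw [Real.log_div (Real.rpow_pos_of_pos hn0 _).ne' hp0.ne', Real.log_rpow hn0, Real.log_rpow hn0]
    have hden : 0 < θExp - tPt (i + 1) := by linarith
    have hs₁ : 0 < gExp / (θExp - tPt (i + 1)) := div_pos hg0 hden
    -- `(θ - t_{i+1})/g ≤ s_p`
    have hle1 : (θExp - tPt (i + 1)) / gExp ≤ (θExp * Real.log n - Real.log p) / (gExp * Real.log n) := by
      rw [div_le_div_iff₀ hg0 (mul_pos hg0 hlogn)]
      nlinarith
    have hs1 : (θExp * Real.log n - Real.log p) / (gExp * Real.log n) ≤ iwaniecSiftingLimit 2 + 1 := by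
      refine le_trans ?_ sMax_le_beta_add_one
      rw [div_le_div_iff₀ (mul_pos hg0 hlogn) hg0]
      have : gExp * Real.log n ≤ Real.log p := le_trans (mul_le_mul_of_nonneg_right hti hlogn.le) hlo
      nlinarith
    rw [hs]
    have h := BetaSieveTwo.iwaniecUpperSieveFun_two_le_of_le (div_pos hden hg0) hle1 hs1
    have e : iwaniecSieveConst 2 / ((θExp - tPt (i + 1)) / gExp) ^ 2 =
        iwaniecSieveConst 2 * (gExp / (θExp - tPt (i + 1))) ^ 2 := by
      rw [div_pow, div_pow, div_div_eq_mul_div, mul_div_assoc]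
    rw [e] at h
    exact h

/-- **The algebra of the piece bound**: for `A, C, ℓ, ε ≥ 0`,
`∑_{i<197} (1 − t_i/α)(A (g/(θ−t_{i+1}))² + Cℓ)(2/(73+i) + ε) ≤ A S_K + 197 A ε + Cℓ (6 + 197 ε)`.
[folklore] -/
theorem sum_pieces_le {A C ℓ ε : ℝ} (hA : 0 ≤ A) (hC : 0 ≤ C) (hℓ : 0 ≤ ℓ) (hε : 0 ≤ ε) :
    ∑ i ∈ range 197, (1 - tPt i / αExp) * (A * (gExp / (θExp - tPt (i + 1))) ^ 2 + C * ℓ) *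
        (2 / (73 + (i : ℝ)) + ε) ≤
      A * pieceSum + 197 * A * ε + C * ℓ * (6 + 197 * ε) := by
  have hterm : ∀ i ∈ range 197,
      (1 - tPt i / αExp) * (A * (gExp / (θExp - tPt (i + 1))) ^ 2 + C * ℓ) * (2 / (73 + (i : ℝ)) + ε) ≤
        A * (pieceCoeff i * (2 / (73 + (i : ℝ)))) + (A * ε + C * ℓ * (2 / 73 + ε)) := by
    intro i hi
    rw [Finset.mem_range] at hi
    obtain ⟨hc0, hc1⟩ := pieceCoeff_nonneg_le_one i hi
    have hw : 0 ≤ 1 - tPt i / αExp ∧ 1 - tPt i / αExp ≤ 1 := by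
      rw [tPt_apply, αExp]
      have hi' : (i : ℝ) ≤ 196 := by exact_mod_cast Nat.lt_succ_iff.mp hi
      constructor
      · rw [sub_nonneg, div_le_one (by norm_num)]; linarith
      · rw [sub_le_self_iff]; positivity
    have hfrac : 2 / (73 + (i : ℝ)) ≤ 2 / 73 :=
      div_le_div_of_nonneg_left (by norm_num) (by norm_num) (by linarith [(Nat.cast_nonneg i : (0:ℝ) ≤ i)])
    have hfrac0 : 0 ≤ 2 / (73 + (i : ℝ)) := by positivity
    have e : (1 - tPt i / αExp) * (A * (gExp / (θExp - tPt (i + 1))) ^ 2 + C * ℓ) * (2 / (73 + (i : ℝ)) + ε) =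
        A * (pieceCoeff i * (2 / (73 + (i : ℝ)))) + A * pieceCoeff i * ε +
          (1 - tPt i / αExp) * (C * ℓ) * (2 / (73 + (i : ℝ)) + ε) := by
      rw [pieceCoeff]; ring
    rw [e]
    have h1 : A * pieceCoeff i * ε ≤ A * ε := by
      have := mul_le_mul_of_nonneg_left hc1 (mul_nonneg hA hε)
      nlinarith
    have h2 : (1 - tPt i / αExp) * (C * ℓ) * (2 / (73 + (i : ℝ)) + ε) ≤ C * ℓ * (2 / 73 + ε) := by
      have hCℓ : 0 ≤ C * ℓ := mul_nonneg hC hℓ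
      calc (1 - tPt i / αExp) * (C * ℓ) * (2 / (73 + (i : ℝ)) + ε)
          ≤ 1 * (C * ℓ) * (2 / (73 + (i : ℝ)) + ε) := by gcongr; exact hw.2
        _ ≤ 1 * (C * ℓ) * (2 / 73 + ε) := by gcongr
        _ = C * ℓ * (2 / 73 + ε) := by ring
    linarith
  calc ∑ i ∈ range 197, (1 - tPt i / αExp) * (A * (gExp / (θExp - tPt (i + 1))) ^ 2 + C * ℓ) *
          (2 / (73 + (i : ℝ)) + ε)
      ≤ ∑ i ∈ range 197, (A * (pieceCoeff i * (2 / (73 + (i : ℝ)))) + (A * ε + C * ℓ * (2 / 73 + ε))) :=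
        Finset.sum_le_sum hterm
    _ = A * pieceSum + 197 * (A * ε + C * ℓ * (2 / 73 + ε)) := by
        rw [Finset.sum_add_distrib, ← Finset.mul_sum, Finset.sum_const, Finset.card_range, nsmul_eq_mul,
          pieceSum]
        push_cast; ring
    _ ≤ A * pieceSum + 197 * A * ε + C * ℓ * (6 + 197 * ε) := by
        have hCℓ : 0 ≤ C * ℓ := mul_nonneg hC hℓ
        nlinarith

/-! ### The weighted prime sum -/

variable {f : ℤ[X]}

/-- The weighted prime sum `T(N) = ∑_{z ≤ p < y} (1 − log p/log y) S_p(N, z)` with `z = N^g`,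
`y = N^α`, `S_p(N, z) = #{1 ≤ n ≤ N : (f(n), P(z)) = 1, p ∣ f(n)}`.
[cite: DiamondHalberstam1997, Thm 1 (proof via HR Thm 10.1)] -/
def Tsum (f : ℤ[X]) (N : ℕ) : ℝ :=
  ∑ p ∈ primesIn ((N : ℝ) ^ gExp) ((N : ℝ) ^ αExp), logWeight ((N : ℝ) ^ αExp) p *
    (#((Ioc 0 N).filter fun n : ℕ =>
      (f.eval (n : ℤ)).natAbs.Coprime (primesProdBelow ((N : ℝ) ^ gExp)) ∧ (p : ℤ) ∣ f.eval (n : ℤ)) : ℝ)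

/-- The constant `L₀ = 106 e^{106/log 2}` of `hasIwaniecDimension_rootDensity`. [folklore] -/
def L₀ : ℝ := 106 * Real.exp (106 / Real.log 2)

/-- `0 ≤ L₀`. [folklore] -/
theorem L₀_nonneg : 0 ≤ L₀ := by unfold L₀; positivity

/-- **Termwise step of the weighted prime sum**: for a prime `p` with `z ≤ p < y` (`z = N^g`,
`y = N^α`, `D = N^θ`, `N^g ≥ 2`), the upper-bound sieve for `S_p` at level `D/p` (hypothesis `hC`,
the conclusion of `PolySieveTwo.card_coprime_dvd_le`) gives
`(1 − log p/log y) S_p ≤ N V(z) g(p) φ(p) + D e⁸ log² z · g(p)` with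
`φ(p) = (1 − log p/log y)(F₂(log(D/p)/log z) + C ℓ_N)`, `g(p) = ω_f(p)/p`.
[cite: DiamondHalberstam1997, Thm 1 (proof via HR Thm 10.1)] -/
theorem termwise_le (h2 : polyRootCountMod ![f] 2 ≤ 1)
    (hle : ∀ p : ℕ, p.Prime → polyRootCountMod ![f] p ≤ 2) {C : ℝ} (hC0 : 0 ≤ C)
    (hC : ∀ (N : ℕ) (x z y : ℝ) (p : ℕ), p.Prime → z ≤ (p : ℝ) → 2 ≤ z → z ≤ y →
      (∀ n ∈ Ioc 0 N, 0 < f.eval (n : ℤ) ∧ ((f.eval (n : ℤ) : ℤ) : ℝ) ≤ x) →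
        (#((Ioc 0 N).filter fun n : ℕ =>
            (f.eval (n : ℤ)).natAbs.Coprime (primesProdBelow z) ∧ (p : ℤ) ∣ f.eval (n : ℤ)) : ℝ) ≤
          (polyRootCountMod ![f] p : ℝ) *
            ((N : ℝ) / p * (∏ q ∈ Nat.primesBelow ⌈z⌉₊, (1 - (polyRootCountMod ![f] q : ℝ) / q)) *
                (iwaniecUpperSieveFun 2 (Real.log y / Real.log z) + C * Real.log y ^ (-(1 / 3 : ℝ))) +
              y * (Real.exp 8 * Real.log z ^ 2)))
    {N : ℕ} {x : ℝ} (hN : 2 ≤ (N : ℝ) ^ gExp)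
    (hx : ∀ n ∈ Ioc 0 N, 0 < f.eval (n : ℤ) ∧ ((f.eval (n : ℤ) : ℤ) : ℝ) ≤ x)
    {p : ℕ} (hp : p ∈ primesIn ((N : ℝ) ^ gExp) ((N : ℝ) ^ αExp)) :
    logWeight ((N : ℝ) ^ αExp) p *
        (#((Ioc 0 N).filter fun n : ℕ =>
          (f.eval (n : ℤ)).natAbs.Coprime (primesProdBelow ((N : ℝ) ^ gExp)) ∧ (p : ℤ) ∣ f.eval (n : ℤ)) : ℝ) ≤
      (N : ℝ) * (∏ q ∈ Nat.primesBelow ⌈(N : ℝ) ^ gExp⌉₊, (1 - (polyRootCountMod ![f] q : ℝ) / q)) *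
          (rootDensity f p * (logWeight ((N : ℝ) ^ αExp) p *
            (iwaniecUpperSieveFun 2 (Real.log ((N : ℝ) ^ θExp / p) / Real.log ((N : ℝ) ^ gExp)) +
              C * ((θExp - αExp) * Real.log N) ^ (-(1 / 3 : ℝ))))) +
        (N : ℝ) ^ θExp * (Real.exp 8 * Real.log ((N : ℝ) ^ gExp) ^ 2) * rootDensity f p := by
  set n : ℝ := (N : ℝ) with hndef
  have hg0 : 0 < gExp := by rw [gExp]; norm_num
  have hα0 : 0 < αExp := by rw [αExp]; norm_num
  have hgα : gExp < αExp := by rw [gExp, αExp]; norm_num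
  have hθα : αExp < θExp := by rw [αExp, θExp]; norm_num
  have hsum : gExp + αExp ≤ θExp := by rw [gExp, αExp, θExp]; norm_num
  have hn1 : 1 < n := one_lt_of_two_le_rpow (Nat.cast_nonneg N) hg0 hN
  have hn0 : 0 < n := by linarith
  have hlogn : 0 < Real.log n := Real.log_pos hn1
  set z : ℝ := n ^ gExp with hzdef
  set y : ℝ := n ^ αExp with hydef
  set D : ℝ := n ^ θExp with hDdef
  set V : ℝ := ∏ q ∈ Nat.primesBelow ⌈z⌉₊, (1 - (polyRootCountMod ![f] q : ℝ) / q) with hVdef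
  set ℓ : ℝ := ((θExp - αExp) * Real.log n) ^ (-(1 / 3 : ℝ)) with hℓdef
  set e8 : ℝ := Real.exp 8 * Real.log z ^ 2 with he8
  have hz2 : 2 ≤ z := hN
  have hzy : z ≤ y := Real.rpow_le_rpow_of_exponent_le hn1.le hgα.le
  have hy1 : 1 < y := by linarith
  have hV : 0 < V := prod_one_sub_rootCount_pos h2 hle z
  have hA : 0 < iwaniecSieveConst 2 := BetaSieveTwo.iwaniecSieveConst_two_pos
  have hℓ0 : 0 ≤ ℓ := Real.rpow_nonneg (mul_pos (by linarith) hlogn).le _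
  have he80 : 0 ≤ e8 := by positivity
  have hD0 : 0 ≤ D := (Real.rpow_pos_of_pos hn0 _).le
  obtain ⟨hpp, hzp, hpy⟩ := mem_primesIn.mp hp
  obtain ⟨-, hlo, hhi⟩ := log_bounds_of_mem_primesIn hn1 (a := gExp) (b := αExp) hp
  have hp0 : (0 : ℝ) < p := by exact_mod_cast hpp.pos
  -- level `D/p ≥ z`
  have hzDp : z ≤ D / p := by
    rw [le_div_iff₀ hp0]
    calc z * p ≤ z * y := mul_le_mul_of_nonneg_left hpy.le (by linarith)
      _ = n ^ (gExp + αExp) := by rw [hzdef, hydef, ← Real.rpow_add hn0]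
      _ ≤ D := Real.rpow_le_rpow_of_exponent_le hn1.le hsum
  have hS := hC N x z (D / p) p hpp hzp hz2 hzDp hx
  -- the error term `(log(D/p))^{-1/3} ≤ ℓ`
  have hlogDp_eq : Real.log (D / p) = θExp * Real.log n - Real.log p := by
    rw [Real.log_div (Real.rpow_pos_of_pos hn0 _).ne' hp0.ne', Real.log_rpow hn0]
  have hlogDp : (θExp - αExp) * Real.log n ≤ Real.log (D / p) := by rw [hlogDp_eq]; linarith
  have hpos1 : 0 < (θExp - αExp) * Real.log n := mul_pos (by linarith) hlogn
  have hαθn : αExp * Real.log n ≤ θExp * Real.log n := mul_le_mul_of_nonneg_right hθα.le hlogn.le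
  have herr : Real.log (D / p) ^ (-(1 / 3 : ℝ)) ≤ ℓ :=
    Real.rpow_le_rpow_of_nonpos hpos1 hlogDp (by norm_num)
  -- the sieve function at `s_p ∈ (0, β+1]` is `A/s_p² ≥ 0`
  set F := iwaniecUpperSieveFun 2 (Real.log (D / p) / Real.log z) with hFdef
  have hF0 : 0 ≤ F := by
    have hs : Real.log (D / p) / Real.log z = (θExp * Real.log n - Real.log p) / (gExp * Real.log n) := by
      rw [hlogDp_eq, hzdef, Real.log_rpow hn0]
    have hs0 : 0 < (θExp * Real.log n - Real.log p) / (gExp * Real.log n) := by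
      apply div_pos _ (mul_pos hg0 hlogn); linarith
    have hs1 : (θExp * Real.log n - Real.log p) / (gExp * Real.log n) ≤ iwaniecSiftingLimit 2 + 1 := by
      refine le_trans ?_ sMax_le_beta_add_one
      have hnum : θExp * Real.log n - Real.log p ≤ (θExp - gExp) * Real.log n := by linarith
      calc (θExp * Real.log n - Real.log p) / (gExp * Real.log n)
          ≤ ((θExp - gExp) * Real.log n) / (gExp * Real.log n) :=
            div_le_div_of_nonneg_right hnum (mul_pos hg0 hlogn).le
        _ = (θExp - gExp) / gExp := by rw [mul_div_mul_right _ _ hlogn.ne']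
    rw [hFdef, hs, BetaSieveTwo.iwaniecUpperSieveFun_two_eq hs0 hs1]
    exact div_nonneg hA.le (sq_nonneg _)
  have hlw0 : 0 ≤ logWeight y p := (logWeight_pos hy1 hpp.pos hpy).le
  have hlw1 : logWeight y p ≤ 1 := logWeight_le_one hy1 p
  have hω0 : (0 : ℝ) ≤ polyRootCountMod ![f] p := Nat.cast_nonneg _
  -- `S_p ≤ ω(p) ((n/p) V (F + C ℓ) + (D/p) e8)`
  have hNV : 0 ≤ n / p * V := mul_nonneg (div_nonneg hn0.le hp0.le) hV.le
  have hS' : (#((Ioc 0 N).filter fun m : ℕ =>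
      (f.eval (m : ℤ)).natAbs.Coprime (primesProdBelow z) ∧ (p : ℤ) ∣ f.eval (m : ℤ)) : ℝ) ≤
      (polyRootCountMod ![f] p : ℝ) * (n / p * V * (F + C * ℓ) + D / p * e8) := by
    refine hS.trans (mul_le_mul_of_nonneg_left ?_ hω0)
    have h1 : C * Real.log (D / p) ^ (-(1 / 3 : ℝ)) ≤ C * ℓ := mul_le_mul_of_nonneg_left herr hC0
    have h2 := mul_le_mul_of_nonneg_left h1 hNV
    linarith
  -- through the density `g(p) = ω(p)/p`
  have hg : rootDensity f p = (polyRootCountMod ![f] p : ℝ) / p := rootDensity_apply f p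
  have e1 : (polyRootCountMod ![f] p : ℝ) * (n / p * V * (F + C * ℓ) + D / p * e8) =
      n * V * (rootDensity f p * (F + C * ℓ)) + D * e8 * rootDensity f p := by
    rw [hg, div_eq_mul_inv, div_eq_mul_inv, div_eq_mul_inv]; ring
  rw [e1] at hS'
  have hgp0 : 0 ≤ rootDensity f p := rootDensity_nonneg f p
  calc logWeight y p * (#((Ioc 0 N).filter fun m : ℕ =>
        (f.eval (m : ℤ)).natAbs.Coprime (primesProdBelow z) ∧ (p : ℤ) ∣ f.eval (m : ℤ)) : ℝ)
      ≤ logWeight y p * (n * V * (rootDensity f p * (F + C * ℓ)) + D * e8 * rootDensity f p) :=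
        mul_le_mul_of_nonneg_left hS' hlw0
    _ = n * V * (rootDensity f p * (logWeight y p * (F + C * ℓ))) +
          logWeight y p * (D * e8 * rootDensity f p) := by ring
    _ ≤ n * V * (rootDensity f p * (logWeight y p * (F + C * ℓ))) + 1 * (D * e8 * rootDensity f p) := by
        have h0 : 0 ≤ D * e8 * rootDensity f p := mul_nonneg (mul_nonneg hD0 he80) hgp0
        have := mul_le_mul_of_nonneg_right hlw1 h0
        linarith
    _ = n * V * (rootDensity f p * (logWeight y p * (F + C * ℓ))) + D * e8 * rootDensity f p := by ring

/-- **The weighted prime sum, evaluated** (dimension `2`, Iwaniec's `F₂` on `K = 197` pieces): if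
`ω_f(2) ≤ 1` and `ω_f(p) ≤ 2` for all primes, there is `C ≥ 0` such that for all `N` with
`N^g ≥ 2` and all `x` with `0 < f(n) ≤ x` on `(0, N]`,
`T(N) ≤ N V(z) (A₂ S_K + 197 A₂ ε_N + C ℓ_N (6 + 197 ε_N)) + D e⁸ log² z (6 + ε_N)`, where
`z = N^g`, `D = N^θ`, `V(z) = ∏_{p<z}(1 − ω_f(p)/p)`, `ε_N = L₀/(g log N)`,
`ℓ_N = ((θ − α) log N)^{−1/3}`. [cite: DiamondHalberstam1997, Thm 1 (1)] -/
theorem weightedPrimeSum_le (h2 : polyRootCountMod ![f] 2 ≤ 1)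
    (hle : ∀ p : ℕ, p.Prime → polyRootCountMod ![f] p ≤ 2) :
    ∃ C : ℝ, 0 ≤ C ∧ ∀ (N : ℕ) (x : ℝ), 2 ≤ (N : ℝ) ^ gExp →
      (∀ n ∈ Ioc 0 N, 0 < f.eval (n : ℤ) ∧ ((f.eval (n : ℤ) : ℤ) : ℝ) ≤ x) →
        Tsum f N ≤
          (N : ℝ) * (∏ q ∈ Nat.primesBelow ⌈(N : ℝ) ^ gExp⌉₊, (1 - (polyRootCountMod ![f] q : ℝ) / q)) *
              (iwaniecSieveConst 2 * pieceSum + 197 * iwaniecSieveConst 2 * (L₀ / (gExp * Real.log N)) +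
                C * ((θExp - αExp) * Real.log N) ^ (-(1 / 3 : ℝ)) *
                  (6 + 197 * (L₀ / (gExp * Real.log N)))) +
            (N : ℝ) ^ θExp * (Real.exp 8 * Real.log ((N : ℝ) ^ gExp) ^ 2) * (6 + L₀ / (gExp * Real.log N)) := by
  have hdim : HasIwaniecDimension (rootDensity f) 2 L₀ := hasIwaniecDimension_rootDensity h2 hle
  obtain ⟨C, hC0, hC⟩ := PolySieveTwo.card_coprime_dvd_le h2 hle hdim
  refine ⟨C, hC0, fun N x hN hx => ?_⟩
  set n : ℝ := (N : ℝ) with hndef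
  have hg0 : 0 < gExp := by rw [gExp]; norm_num
  have hα0 : 0 < αExp := by rw [αExp]; norm_num
  have hgα : gExp < αExp := by rw [gExp, αExp]; norm_num
  have hθα : αExp < θExp := by rw [αExp, θExp]; norm_num
  have hn1 : 1 < n := one_lt_of_two_le_rpow (Nat.cast_nonneg N) hg0 hN
  have hn0 : 0 < n := by linarith
  have hlogn : 0 < Real.log n := Real.log_pos hn1
  set z : ℝ := n ^ gExp with hzdef
  set y : ℝ := n ^ αExp with hydef
  set D : ℝ := n ^ θExp with hDdef
  set V : ℝ := ∏ q ∈ Nat.primesBelow ⌈z⌉₊, (1 - (polyRootCountMod ![f] q : ℝ) / q) with hVdef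
  set A := iwaniecSieveConst 2 with hAdef
  set ε : ℝ := L₀ / (gExp * Real.log n) with hεdef
  set ℓ : ℝ := ((θExp - αExp) * Real.log n) ^ (-(1 / 3 : ℝ)) with hℓdef
  set e8 : ℝ := Real.exp 8 * Real.log z ^ 2 with he8
  have hz2 : 2 ≤ z := hN
  have hzy : z ≤ y := Real.rpow_le_rpow_of_exponent_le hn1.le hgα.le
  have hV : 0 < V := prod_one_sub_rootCount_pos h2 hle z
  have hA : 0 < A := BetaSieveTwo.iwaniecSieveConst_two_pos
  have hL0 : 0 ≤ L₀ := L₀_nonneg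
  have hε0 : 0 ≤ ε := div_nonneg hL0 (mul_nonneg hg0.le hlogn.le)
  have hℓ0 : 0 ≤ ℓ := Real.rpow_nonneg (mul_pos (by linarith) hlogn).le _
  have he80 : 0 ≤ e8 := by positivity
  have hD0 : 0 ≤ D := (Real.rpow_pos_of_pos hn0 _).le
  set φ : ℕ → ℝ := fun p => logWeight y p *
    (iwaniecUpperSieveFun 2 (Real.log (D / p) / Real.log z) + C * ℓ) with hφ
  -- Steps A–B: termwise bound and summation
  have hB : Tsum f N ≤ n * V * ∑ p ∈ primesIn z y, rootDensity f p * φ p +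
      D * e8 * ∑ p ∈ primesIn z y, rootDensity f p := by
    unfold Tsum
    rw [Finset.mul_sum, Finset.mul_sum, ← Finset.sum_add_distrib]
    exact Finset.sum_le_sum fun p hp => termwise_le h2 hle hC0 hC hN hx hp
  -- Step C: the plain density sum `∑ g(p) ≤ 6 + ε`
  have hC_step : ∑ p ∈ primesIn z y, rootDensity f p ≤ 6 + ε := by
    have h := sum_density_primesIn_le hdim hz2 hzy
    have hlog : Real.log (Real.log y / Real.log z) ≤ 197 / 73 := by
      have e : Real.log y / Real.log z = αExp / gExp := by
        rw [hydef, hzdef, Real.log_rpow hn0, Real.log_rpow hn0]; field_simp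
      rw [e]
      have := Real.log_le_sub_one_of_pos (div_pos hα0 hg0)
      rw [αExp, gExp] at this ⊢
      norm_num at this ⊢
      linarith
    have e2 : L₀ / Real.log z = ε := by rw [hzdef, Real.log_rpow hn0]
    rw [e2] at h
    linarith
  -- Step D: the pieces
  set u : ℕ → ℝ := fun i => n ^ tPt i with hu
  have humono : Monotone u := fun i j hij => Real.rpow_le_rpow_of_exponent_le hn1.le (tPt_mono hij)
  have hu0 : u 0 = z := by simp only [hu, tPt_zero, hzdef]
  have hu197 : u 197 = y := by simp only [hu, tPt_197, hydef]
  set M : ℕ → ℝ := fun i => (1 - tPt i / αExp) * (A * (gExp / (θExp - tPt (i + 1))) ^ 2 + C * ℓ) with hM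
  have hw0 : ∀ i, i < 197 → 0 ≤ 1 - tPt i / αExp := by
    intro i hi
    have hi' : (i : ℝ) ≤ 196 := by exact_mod_cast Nat.lt_succ_iff.mp hi
    rw [tPt_apply, αExp, sub_nonneg, div_le_one (by norm_num)]; linarith
  have hin : ∀ i, 0 ≤ A * (gExp / (θExp - tPt (i + 1))) ^ 2 + C * ℓ := fun i =>
    add_nonneg (mul_nonneg hA.le (sq_nonneg _)) (mul_nonneg hC0 hℓ0)
  have hM0 : ∀ i, i < 197 → 0 ≤ M i := fun i hi => mul_nonneg (hw0 i hi) (hin i)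
  have hMφ : ∀ i, i < 197 → ∀ p ∈ primesIn (u i) (u (i + 1)), 0 ≤ φ p ∧ φ p ≤ M i := by
    intro i hi p hp
    obtain ⟨hlw0, hlw1, hF0, hF1⟩ := piece_pointwise hn1 hi hp
    refine ⟨mul_nonneg hlw0 (add_nonneg hF0 (mul_nonneg hC0 hℓ0)), ?_⟩
    exact mul_le_mul hlw1 (by linarith) (add_nonneg hF0 (mul_nonneg hC0 hℓ0)) (hw0 i hi)
  have hD_step : ∑ p ∈ primesIn z y, rootDensity f p * φ p ≤
      ∑ i ∈ range 197, M i * (2 / (73 + (i : ℝ)) + ε) := by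
    have h := sum_mul_le_of_pieces hdim humono (by rw [hu0]; exact hz2) 197 hM0 hMφ
    rw [hu0, hu197] at h
    refine h.trans (Finset.sum_le_sum fun i hi => ?_)
    rw [Finset.mem_range] at hi
    apply mul_le_mul_of_nonneg_left _ (hM0 i hi)
    have hti0 : 0 < tPt i := by rw [tPt_apply]; positivity
    have e1 : Real.log (u (i + 1)) / Real.log (u i) = tPt (i + 1) / tPt i := by
      simp only [hu]
      rw [Real.log_rpow hn0, Real.log_rpow hn0]
      field_simp
    have e2 : L₀ / Real.log (u i) = L₀ / (tPt i * Real.log n) := by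
      simp only [hu]; rw [Real.log_rpow hn0]
    rw [e1, e2]
    have h1 := log_tPt_succ_div_le i
    have h2 : L₀ / (tPt i * Real.log n) ≤ ε := by
      rw [hεdef]
      apply div_le_div_of_nonneg_left hL0 (mul_pos hg0 hlogn)
      exact mul_le_mul_of_nonneg_right (gExp_le_tPt i) hlogn.le
    have : (2 : ℝ) / (73 + (i : ℝ)) = 2 * (1 / (73 + i)) := by ring
    linarith
  -- Step E: the algebra, and assembly
  have hE := sum_pieces_le (ε := ε) hA.le hC0 hℓ0 hε0
  have hNV : 0 ≤ n * V := mul_nonneg hn0.le hV.le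
  have hDe : 0 ≤ D * e8 := mul_nonneg hD0 he80
  have h1 := mul_le_mul_of_nonneg_left (hD_step.trans hE) hNV
  have h2 := mul_le_mul_of_nonneg_left hC_step hDe
  linarith

end DH97

end Literature.NumberTheory.Sieve

end
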